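import Summits.BirchSwinnertonDyer.BirchSwinnertonDyer.Theorems.ClassRecordThreeEulerHalvesAtThreeCartanTorusCubeCutPSModW
import Summits.BirchSwinnertonDyer.BirchSwinnertonDyer.Theorems.ClassRecordThreeEulerHalvesAtThreeCartanTorusCubeCutPSCube
import HarnessLib

/-!
# Crux 23422 line `cartan` v9, stub (F2a), PRINCIPAL-SERIES half of the torus-cube cut — a vector of `N_U X` outside the Steinberg
# hyperplane (with the cube relation, `hcube`) and a vector inside it whose mirabolic norm is not in `3X` (`hND`)

Seat `bsd-stepL-tam3-p1` g21 (LINE OWNER of crux 23422; `--supports stmt-BirchSwinnertonDyer-23422 --as helper`). Fourth file of the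
construction of the mod-3 line (`W = W 𝓛 f₀ = range Φ̄`, `…PSModW`):
* `exists_normU_not_mem_W`: some `u₀ = N_U x₀` has `red u₀ ∉ W` (`N̄_U` is an idempotent of trace `2` over `𝔽₃` — `q ≡ 1 (3)` — while the
  `U`-fixed part of `W` is a line, by injectivity of `Φ̄` on `I₀` and transitivity of `U` on the finite points);
* `exists_hND`: `x = ρ(g₁)f₀ − ρ(g_∞)f₀ ∈ X_M` has `red (N_D x) = Φ̄(Σ_{a ∈ 𝔽_q^×} ind [a:1]) ≠ 0`;
* `exists_hcube`: `u₀ ∉ X_M` with `u₀ + ρ(δ)u₀ + ρ(δ)²u₀ = 0` (cartan-f2a's `PS.cube_relation_of_unipotentFixed`, `δ = diag(a,1)`, `a` a non-cube).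
HONEST FRAMING: linear algebra over `𝔽₃` on one lattice; S-K1′ is NOT proved here; no summit statement, no route item and no registered
stub is proved; BSD is proved for no curve. [folklore]
-/
namespace Summit.BirchSwinnertonDyer.BirchSwinnertonDyer.Theorems.CartanTorusCubeCut.PSMod

open Summit.BirchSwinnertonDyer.BirchSwinnertonDyer.Theorems.CartanDegree
open Summit.BirchSwinnertonDyer.BirchSwinnertonDyer.Theorems.CartanTorusCubeCut
open Summit.BirchSwinnertonDyer.BirchSwinnertonDyer.Theorems.CartanTorusCubeCut.Steinberg
open scoped LinearAlgebra.Projectivization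

set_option linter.dupNamespace false
set_option autoImplicit false

noncomputable section

open scoped Classical

variable {q : ℕ} [Fact q.Prime]

/-- a unipotent parametrisation agrees with `uGL`. -/
theorem unipotentParam_eq_uGL (u : ZMod q → G q) (hu : ∀ y, ((u y : G q) : Mat q) = !![1, y; 0, 1]) (y : ZMod q) :
    u y = uGL y := Units.ext (by rw [hu, uGL_coe])

omit [Fact q.Prime] in
/-- `q ≡ 1 (mod 3)` read in `ZMod 3`. -/
theorem natCast_q_eq_one (h1 : q % 3 = 1) : (q : ZMod 3) = 1 := by
  rw [← ZMod.natCast_mod, h1]; rfl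

omit [Fact q.Prime] in
/-- `3 ∤ q + 1` when `q ≡ 1 (mod 3)`. -/
theorem not_three_dvd_succ (h1 : q % 3 = 1) : ¬ 3 ∣ q + 1 := by omega

section Close
variable (𝓛 : CartanTorusLattice q) (f₀ : Fin 𝓛.d → ℤ)
variable (u : ZMod q → G q) (hu : ∀ y, ((u y : G q) : Mat q) = !![1, y; 0, 1])

/-- a `U`-fixed element of `W` is a multiple of `Φ̄ c₁`, `c₁ = (inf ↦ −q, fin t ↦ 1)`. -/
theorem ufixed_mem_span (hq3 : ¬ 3 ∣ q + 1) (hf0 : ¬ ThreeDvd f₀)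
    (hstab : ∀ g : G q, (g : Mat q) 1 0 = 0 → ThreeDvd (𝓛.ρ g f₀ - f₀))
    {w : Fin 𝓛.d → ZMod 3} (hw : w ∈ W 𝓛 f₀) (hfix : ∀ y : ZMod q, PS.redEnd 𝓛.d (𝓛.ρ (uGL y)) w = w) :
    w ∈ (ZMod 3) ∙ Phi 𝓛 f₀ (fun p => if p = inf then -(q : ZMod 3) else 1) := by
  rw [W_eq_map_I0 𝓛 f₀ hstab hq3] at hw
  obtain ⟨c, hc, rfl⟩ := hw
  rw [SetLike.mem_coe, mem_I0] at hc
  -- `c` is `U`-invariant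
  have hinv : ∀ y, tr (uGL y) c = c := by
    intro y
    have h0 : tr (uGL y) c - c = 0 := by
      apply Phi_injective_on_aug 𝓛 f₀ hstab hq3 hf0
      · rw [show tr (uGL y) c - c = tr (uGL y) c + (-1 : ZMod 3) • c by rw [neg_one_smul, sub_eq_add_neg],
          tot_add, tot_smul, tot_tr, hc]; ring
      · rw [map_sub, ← redEnd_rho_Phi 𝓛 f₀ hstab, hfix, sub_self]
    exact sub_eq_zero.1 h0
  have hconst : ∀ t : ZMod q, c (fin t) = c (fin 0) := by
    intro t
    have := congrFun (hinv (-t)) (fin 0)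
    rw [tr_apply, uGL_inv, neg_neg, uGL_smul_fin, zero_add] at this
    exact this
  have hinf : c inf = -(q : ZMod 3) * c (fin 0) := by
    have h := hc
    rw [tot, Finset.sum_congr rfl (fun t _ => hconst t), Finset.sum_const, Finset.card_univ, ZMod.card,
      nsmul_eq_mul] at h
    linear_combination h
  rw [Submodule.mem_span_singleton]
  refine ⟨c (fin 0), ?_⟩
  rw [← map_smul]
  congr 1
  funext p
  rw [Pi.smul_apply, smul_eq_mul]
  rcases eq_inf_or_fin p with rfl | ⟨t, rfl⟩
  · rw [if_pos rfl, hinf]; ring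
  · rw [if_neg (fin_ne_inf t), hconst t, mul_one]

include hu

/-- **some `u₀ = N_U x₀` reduces outside `W`** (`q ≡ 1 (mod 3)`). -/
theorem exists_normU_not_mem_W (h1 : q % 3 = 1) (hf0 : ¬ ThreeDvd f₀)
    (hstab : ∀ g : G q, (g : Mat q) 1 0 = 0 → ThreeDvd (𝓛.ρ g f₀ - f₀)) :
    ∃ x₀ : Fin 𝓛.d → ℤ, PS.red 𝓛.d ((∑ y : ZMod q, 𝓛.ρ (u y)) x₀) ∉ W 𝓛 f₀ := by
  have hq3 := not_three_dvd_succ h1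
  by_contra hall
  push Not at hall
  set NU : Module.End ℤ (Fin 𝓛.d → ℤ) := ∑ y : ZMod q, 𝓛.ρ (u y) with hNU
  set Nb := PS.redEnd 𝓛.d NU with hNb
  -- `N̄` is an idempotent over `𝔽₃` of trace `2`
  have hid : IsIdempotentElem Nb := by
    rw [IsIdempotentElem, hNb, ← PS.redEnd_mul, PS.normU_mul_self u hu 𝓛, PS.redEnd_zsmul, Int.cast_natCast,
      natCast_q_eq_one h1, one_smul]
  have htr : LinearMap.trace (ZMod 3) _ Nb = 2 := by
    rw [hNb, PS.trace_redEnd, PS.trace_normU u hu 𝓛 h1]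
    push_cast
    rw [natCast_q_eq_one h1, mul_one]
  have hrank := (LinearMap.IsIdempotentElem.isProj_range Nb hid).trace
  rw [htr] at hrank
  -- the range of `N̄` lies in the line spanned by `Φ̄ c₁`
  set v₁ := Phi 𝓛 f₀ (fun p => if p = inf then -(q : ZMod 3) else 1) with hv₁
  have hle : LinearMap.range Nb ≤ (ZMod 3) ∙ v₁ := by
    rintro w ⟨y, rfl⟩
    obtain ⟨x, rfl⟩ := PS.red_surjective 𝓛.d y
    rw [hNb, PS.redEnd_red]
    apply ufixed_mem_span 𝓛 f₀ hq3 hf0 hstab (hall x)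
    intro y
    rw [PS.redEnd_red, ← Module.End.mul_apply, ← unipotentParam_eq_uGL u hu, rho_unipotent_mul_normU u hu]
  have hfin : Module.finrank (ZMod 3) (LinearMap.range Nb) ≤ 1 := by
    calc Module.finrank (ZMod 3) (LinearMap.range Nb) ≤ Module.finrank (ZMod 3) ((ZMod 3) ∙ v₁) :=
          Submodule.finrank_mono hle
      _ ≤ Module.finrank (ZMod 3) (ZMod 3) := by
          rw [LinearMap.span_singleton_eq_range]; exact LinearMap.finrank_range_le _
      _ = 1 := Module.finrank_self _
  interval_cases h : Module.finrank (ZMod 3) (LinearMap.range Nb) <;> simp_all <;> revert hrank <;> decide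

/-- `N_U x` is fixed by every upper unipotent element. -/
theorem normU_fixed (x : Fin 𝓛.d → ℤ) (g : G q) (h10 : (g : Mat q) 1 0 = 0) (h00 : (g : Mat q) 0 0 = 1)
    (h11 : (g : Mat q) 1 1 = 1) : 𝓛.ρ g ((∑ y : ZMod q, 𝓛.ρ (u y)) x) = (∑ y : ZMod q, 𝓛.ρ (u y)) x := by
  have hg : g = u ((g : Mat q) 0 1) := by
    apply Units.ext; rw [hu]; ext i j; fin_cases i <;> fin_cases j <;> simp [h10, h00, h11]
  rw [hg]
  exact rho_unipotent_apply_normU u hu 𝓛 _ x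

omit hu in
/-- a generator of `𝔽_q^×` is not a cube root (`q ≡ 1 (mod 3)`). -/
theorem generator_not_cube (h1 : q % 3 = 1) {a : (ZMod q)ˣ} (ha : ∀ b : (ZMod q)ˣ, b ∈ Submonoid.powers a) :
    (a : ZMod q) ^ ((q - 1) / 3) ≠ 1 := by
  intro hak
  have hall : (Finset.univ.filter fun b : (ZMod q)ˣ => (b : ZMod q) ^ ((q - 1) / 3) = 1) = Finset.univ := by
    apply Finset.filter_true_of_mem
    intro b _
    obtain ⟨n, rfl⟩ := (Submonoid.mem_powers_iff _ _).1 (ha b)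
    rw [Units.val_pow_eq_pow_val, ← pow_mul, mul_comm, pow_mul, hak, one_pow]
  have hk := PS.card_cubeRoots (q := q) h1
  rw [hall, Finset.card_univ, ZMod.card_units] at hk
  have := (Fact.out : q.Prime).two_le
  omega

/-! ### `hND` and `hcube` -/

omit hu in
/-- **`hND`**: some `x ∈ X_M = red⁻¹(W)` has `N_D x ∉ 3X`. -/
theorem exists_hND (h1 : q % 3 = 1) (hf0 : ¬ ThreeDvd f₀)
    (hstab : ∀ g : G q, (g : Mat q) 1 0 = 0 → ThreeDvd (𝓛.ρ g f₀ - f₀)) :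
    ∃ x ∈ ((W 𝓛 f₀).restrictScalars ℤ).comap (PS.red 𝓛.d),
      ¬ ∃ y, (∑ a : (ZMod q)ˣ, 𝓛.ρ (diagGL ![a, 1]) x) = (3 : ℤ) • y := by
  have hq3 := not_three_dvd_succ h1
  refine ⟨𝓛.ρ (mover (fin 1)) f₀ - 𝓛.ρ (mover inf) f₀, ?_, ?_⟩
  · rw [PS.mem_comap_red_iff, map_sub]
    exact (W 𝓛 f₀).sub_mem (vbar_mem_W 𝓛 f₀ _) (vbar_mem_W 𝓛 f₀ _)
  · intro h3
    have hred : PS.red 𝓛.d (∑ a : (ZMod q)ˣ, 𝓛.ρ (diagGL ![a, 1]) (𝓛.ρ (mover (fin 1)) f₀ - 𝓛.ρ (mover inf) f₀)) = 0 :=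
      (PS.red_eq_zero_iff 𝓛.d _).2 h3
    -- compute the reduction through `Φ̄`
    have hact1 : ∀ a : (ZMod q)ˣ, diagGL ![a, 1] • (fin 1 : P1 q) = fin (a : ZMod q) := by
      intro a
      rw [fin, fin, smul_mk_eq]; congr 1; rw [diagGL_coe]
      ext i; fin_cases i <;> simp [Matrix.mulVec, dotProduct, Matrix.diagonal]
    have hactinf : ∀ a : (ZMod q)ˣ, diagGL ![a, 1] • (inf : P1 q) = inf := by
      intro a
      rw [smul_inf_eq_inf_iff, diagGL_coe]; simp [Matrix.diagonal]
    set c'' : P1 q → ZMod 3 := ∑ a : (ZMod q)ˣ, ind (fin (a : ZMod q)) with hc''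
    have hΦ : PS.red 𝓛.d (∑ a : (ZMod q)ˣ, 𝓛.ρ (diagGL ![a, 1]) (𝓛.ρ (mover (fin 1)) f₀ - 𝓛.ρ (mover inf) f₀)) =
        Phi 𝓛 f₀ c'' := by
      rw [map_sum]
      have : ∀ a : (ZMod q)ˣ, PS.red 𝓛.d (𝓛.ρ (diagGL ![a, 1]) (𝓛.ρ (mover (fin 1)) f₀ - 𝓛.ρ (mover inf) f₀)) =
          Phi 𝓛 f₀ (ind (fin (a : ZMod q))) - Phi 𝓛 f₀ (ind inf) := by
        intro a
        have hv : ∀ p : P1 q, PS.red 𝓛.d (𝓛.ρ (mover p) f₀) = vbar 𝓛 f₀ p := fun p => rfl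
        rw [map_sub, map_sub, ← PS.redEnd_red 𝓛.d (𝓛.ρ (diagGL ![a, 1])) (𝓛.ρ (mover (fin 1)) f₀),
          ← PS.redEnd_red 𝓛.d (𝓛.ρ (diagGL ![a, 1])) (𝓛.ρ (mover inf) f₀), hv, hv,
          redEnd_rho_vbar 𝓛 f₀ hstab, redEnd_rho_vbar 𝓛 f₀ hstab, hact1, hactinf, Phi_ind, Phi_ind]
      rw [Finset.sum_congr rfl (fun a _ => this a), Finset.sum_sub_distrib, Finset.sum_const, Finset.card_univ,
        ZMod.card_units, hc'', map_sum]
      have hq1 : ((q - 1 : ℕ) : ZMod 3) = 0 := by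
        have := (Fact.out : q.Prime).one_le
        rw [Nat.cast_sub this, natCast_q_eq_one h1]; ring
      rw [← Nat.cast_smul_eq_nsmul (ZMod 3), hq1, zero_smul, sub_zero]
    rw [hΦ] at hred
    have htot : tot c'' = 0 := by
      rw [hc'', show tot (∑ a : (ZMod q)ˣ, ind (fin (a : ZMod q))) = ∑ a : (ZMod q)ˣ, tot (ind (fin (a : ZMod q)) : P1 q → ZMod 3)
        from map_sum (totLin (q := q)) _ _]
      simp_rw [tot_ind]
      rw [Finset.sum_const, Finset.card_univ, ZMod.card_units, nsmul_eq_mul, mul_one]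
      have := (Fact.out : q.Prime).one_le
      rw [Nat.cast_sub this, natCast_q_eq_one h1]; ring
    have hc0 := Phi_injective_on_aug 𝓛 f₀ hstab hq3 hf0 c'' htot hred
    have : c'' (fin 1) = 1 := by
      rw [hc'', Finset.sum_apply, Finset.sum_eq_single 1]
      · simp [ind]
      · intro b _ hb
        simp only [ind]
        exact if_neg (fun h => hb (Units.ext (Steinberg.fin_injective h).symm))
      · intro h; exact absurd (Finset.mem_univ _) h
    rw [hc0] at this
    exact zero_ne_one this

/-- **`hcube`**: a vector outside `X_M` killed by `1 + ρ(d₀) + ρ(d₀)²` for `d₀ = diag(a,1)`, `a` a non-cube. -/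
theorem exists_hcube (h1 : q % 3 = 1) (hf0 : ¬ ThreeDvd f₀)
    (hstab : ∀ g : G q, (g : Mat q) 1 0 = 0 → ThreeDvd (𝓛.ρ g f₀ - f₀))
    {a : (ZMod q)ˣ} (ha : (a : ZMod q) ^ ((q - 1) / 3) ≠ 1) :
    ∃ (d₀ : G q) (u₀ : Fin 𝓛.d → ℤ), u₀ ∉ ((W 𝓛 f₀).restrictScalars ℤ).comap (PS.red 𝓛.d) ∧
      u₀ + 𝓛.ρ d₀ u₀ + 𝓛.ρ d₀ (𝓛.ρ d₀ u₀) = 0 := by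
  obtain ⟨x₀, hx₀⟩ := exists_normU_not_mem_W 𝓛 f₀ u hu h1 hf0 hstab
  refine ⟨diagGL ![a, 1], (∑ y : ZMod q, 𝓛.ρ (u y)) x₀, ?_, ?_⟩
  · rw [PS.mem_comap_red_iff]; exact hx₀
  · exact PS.cube_relation_of_unipotentFixed u hu 𝓛 h1 ha _
      (fun g h10 h00 h11 => normU_fixed 𝓛 u hu x₀ g h10 h00 h11)

end Close

end

end Summit.BirchSwinnertonDyer.BirchSwinnertonDyer.Theorems.CartanTorusCubeCut.PSMod
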